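import Literature.NumberTheory.EllipticCurves.Kim2026.ShaLengthRankZeroLowerBound
import Literature.NumberTheory.EllipticCurves.Kim2026.ShaLengthRankZeroKuriharaDivisibilityBound
import Literature.NumberTheory.EllipticCurves.CuspFormLFunctionLevelConductorProofs
import Summits.BirchSwinnertonDyer.Rank1Residual.X4.KuriharaLevelReading
import HarnessLib

/-!
# X3/X4 at `p ≥ 5`, rank `0`: the `e`-VERSION of the level-`k` Kurihara certificate — a Kurihara
# number computed modulo `p^k` whose `p`-adic order is `e < k` is a level-`(e+1)` certificate
# (cell `b2b-bsdres`, team n1011, row T-N10K / PLAN R1-6, seat `b2b-bsdres-n1011-p11`; sequel of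
# `X4/KuriharaLowerHalf.lean` / `…Socket.lean`; imports only the fact, `X4/KuriharaLevelReading.lean` and harvest-2's level reduction)

HONEST FRAMING (run/shared/lean/b2b/bsd-rank1-residual/, verbatim in every file): the goal of the
cell is to DELETE the COMBINATION-SHAPED residual classes of the Birch–Swinnerton-Dyer formula for
ALL analytic-rank `≤ 1` elliptic curves over `ℚ` — "full BSD formula for every rank `≤ 1` curve in
class `C`" assembled STRICTLY from published theorems — so that the rank-`≤ 1` remainder becomes
exactly the CONSTRUCTION-SHAPED classes, which are TYPED (missing-input `Prop`s), NOT attempted.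
This is not "finishing BSD". Team n1011: prove what is provable now; shrink each hard class to its
core with data; no claim beyond stated classes. X4 stays CONSTRUCTION-SHAPED; N10 / N11 marks
UNCHANGED; nothing booked. THEOREMS ONLY (no definition, no named fact); PER PAIR, not a class theorem.

## What this file does (PLAN.md R1-6, "the X4 consumer in the e-VERSION: ord_p δ̃_n^{(k)} = e < k ⇒ …")

The census instrument computes ONE Kurihara number `δ̃_n^{(k)} ∈ ℤ/p^k` per level `n ∈ 𝒩_k` and
reads off its `p`-adic order `e` (Kim–Pollack 2025 §8.1.2: "`ord_3(δ̃_{37·1783} mod 9) = 1`"). The named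
fact `Kim2026.rankZero_le_padicValNat_sha_of_kuriharaNumber_ne_zero` (p249207) is stated for a number
NON-ZERO modulo `p^k`, i.e. slack `k − 1`; the sharper slack `e` is obtained by REDUCING THE LEVEL:
`𝒩_k ⊆ 𝒩_{e+1}` (`Kato.IsKolyvaginProduct.mono`) and `δ̃_n^{(e+1)} = δ̃_n^{(k)} mod p^{e+1}`
(harvest-2's `Kim2026.castHom_kuriharaNumber`, with the discrete logarithms reduced by
`Kim2026.reduceLog`; the symbols `[a/n]⁺_f` are `p`-integral for the newform of a curve with `E[p]`
irreducible at a level prime to `N`, `IsNewformOf.not_dvd_den_ratPlusSymbol_div`, and `n ∈ 𝒩_k` IS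
prime to the level of the datum — `coprime_level_of_isKolyvaginProduct`, via the tree theorem
`IsNewformOf.dvd_level_iff_dvd_conductorNorm`, no Carayol input). Hence:

* `den_ratPlusSymbol_coprime_of_isKolyvaginProduct` — the integrality side condition of
  `castHom_kuriharaNumber` DISCHARGED for `D.f` at every `n ∈ 𝒩_k(E,p)`, `p` odd, `E[p]` irreducible;
* **`lOmegaWitness_of_kimLower_of_castHom_ne_zero`** — a level-`k` number whose image in `ℤ/p^{e+1}`
  is non-zero (`e + 1 ≤ k`) gives the output shape with slack `j = e`;
* **`missingLowerBoundAt_rankZero_of_kimLower_of_castHom_ne_zero`** — hence the LOWER half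
  `Typed.MissingLowerBoundAt W p` as soon as `e ≤ ord_p ∏ c_ℓ` (any reduction at `p ≥ 5`, rank `0`,
  `ρ̄` onto, Manin datum, period transfer); the class readings of `X4/KuriharaLowerHalf.lean` and the
  sockets of `X4/KuriharaLowerHalfSocket.lean` then apply verbatim with `k := e + 1`.

References: [Kim2022StructureSelmer] §1.4.2–1.4.3, §1.5.1, Thm. 1.9 (6); [Kim2025RefinedTNC] §8.1.2 (PRE,
context only); [DiamondShurman2005] Prop. 5.8.5 / (8.44); [Miller2011LMS] Def. 1.1.
-/

noncomputable section

open scoped Classical MatrixGroups ModularForm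

open CongruenceSubgroup WeierstrassCurve Literature.NumberTheory.EllipticCurves
  Literature.NumberTheory.EllipticCurves.ModularForms
  Literature.NumberTheory.EllipticCurves.Rank1Residual
  Literature.NumberTheory.EllipticCurves.Rank1Residual.Typed

namespace Summit.BirchSwinnertonDyer.Rank1Residual.X4

variable (W : WeierstrassCurve ℚ) [W.IsElliptic] [W.IsGloballyMinimal] (p : ℕ) [hp : Fact p.Prime]

/-! ### §1 Side conditions of the level reduction, discharged -/

omit hp in
/-- **A Kolyvagin level is prime to the level of any modular parametrisation datum**: `n ∈ 𝒩_k(E,p)`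
is prime to `N_E · p` (`Kato.IsKolyvaginProduct.coprime`), and a prime divides the level `N` of the
newform `D.f` of `E` iff it divides `N_E` (`IsNewformOf.dvd_level_iff_dvd_conductorNorm`, from
`a_{q²} = a_q² − 𝟙(q) q` on both sides — no Carayol input). [cite: DiamondShurman2005, Prop. 5.8.5 and (8.44)] -/
theorem coprime_level_of_isKolyvaginProduct {k n : ℕ} (hn : Kato.IsKolyvaginProduct W p k n)
    {N : ℕ} [NeZero N] (D : ModularParametrizationData W N) : Nat.Coprime n N := by
  refine Nat.coprime_of_dvd fun q hq hqn hqN => ?_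
  have hqE : q ∣ W.conductorNorm ℤ * p :=
    dvd_mul_of_dvd_left ((D.isNewformOf.dvd_level_iff_dvd_conductorNorm hq).mp hqN) p
  exact (Nat.Prime.coprime_iff_not_dvd hq).mp (Nat.Coprime.coprime_dvd_left hqn hn.coprime) hqE

/-- **The symbols `[a/n]⁺_{D.f}` are `p`-integral at a Kolyvagin level** (`p` odd, `E[p]` irreducible):
their denominators are prime to every `p^k` — `IsNewformOf.not_dvd_den_ratPlusSymbol_div` (Kim §1.4.1
"Under our assumptions, we have `[r]⁺ ∈ ℤ_(p)`") at the level `n`, prime to `N` by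
`coprime_level_of_isKolyvaginProduct`. This is the side condition of harvest-2's
`Kim2026.castHom_kuriharaNumber`. [cite: Kim2022StructureSelmer, §1.4.1 (PDF p. 7)] -/
theorem den_ratPlusSymbol_coprime_of_isKolyvaginProduct (hp2 : p ≠ 2) (hirr : Irr W p)
    {k n : ℕ} (hn : Kato.IsKolyvaginProduct W p k n)
    {N : ℕ} [NeZero N] (D : ModularParametrizationData W N) (j : ℕ) (a : ℕ) :
    (ratPlusSymbol D.f ((a : ℚ) / n)).den.Coprime (p ^ j) := by
  have h := D.isNewformOf.not_dvd_den_ratPlusSymbol_div hp2 hirr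
    (coprime_level_of_isKolyvaginProduct W p hn D) (a : ℤ)
  rw [Int.cast_natCast] at h
  exact (((Nat.Prime.coprime_iff_not_dvd hp.out).mpr h).symm).pow_right j

/-! ### §2 The `e`-version: reduce the level to `e + 1` -/

/-- **Output shape with slack `e` from a level-`k` Kurihara number of `p`-adic order `≤ e < k`.** Rank
`0`, `p ≥ 5`, any reduction at `p`, `ρ̄_{E,p}` onto, Manin datum `D`, period transfer, `n ∈ 𝒩_k` with
cyclic reductions, `ψ ↠ ℤ/p^k`, and the image of `δ̃_n^{(k)} = kuriharaNumber D.f (p^k) n ψ` in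
`ℤ/p^{e+1}` NON-ZERO (`e + 1 ≤ k`): then `L(E,1)/Ω(W) = q₀` with `ord_p q₀ − e ≤ ord_p #Ш(E)(p)`.
Proof: `𝒩_k ⊆ 𝒩_{e+1}` (`IsKolyvaginProduct.mono`), `δ̃_n^{(e+1)} = δ̃_n^{(k)} mod p^{e+1}`
(`Kim2026.castHom_kuriharaNumber`, integrality by §1), the reduced logarithms stay surjective
(`Kim2026.reduceLog_surjective`), and the named fact at the level `e + 1`.
[cite: Kim2022StructureSelmer, Thm. 1.9 (6) (PDF p. 8), §1.4.2–1.4.3 and §1.5.1 (PDF p. 7)] -/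
theorem lOmegaWitness_of_kimLower_of_castHom_ne_zero
    (hKim : Kim2026.rankZero_le_padicValNat_sha_of_kuriharaNumber_ne_zero) (hp5 : 5 ≤ p)
    (hsurj : Surj W p) (hL : W.entireLFunction 1 ≠ 0) (hfin : Finite W.sha)
    {N : ℕ} [NeZero N] (D : ModularParametrizationData W N) (hc : ¬ (p : ℤ) ∣ D.maninConstant)
    (hper : ∃ u : ℚ, ‖(u : ℚ_[p])‖ = 1 ∧ W.realPeriodRat = u * plusPeriod D.f)
    (k n : ℕ) [NeZero n] (hn : Kato.IsKolyvaginProduct W p k n)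
    (hcyc : ∀ (ℓ : ℕ) [Fact ℓ.Prime], ℓ ∣ n →
      Nat.card {P : ((WeierstrassCurve.integralModelInt W).map
          (Int.castRingHom (ZMod ℓ))).toAffine.Point // p • P = 0} ≤ p)
    (ψ : (ℓ : ℕ) → (ZMod ℓ)ˣ →* Multiplicative (ZMod (p ^ k)))
    (hψ : ∀ ℓ ∈ n.primeFactors, Function.Surjective (ψ ℓ))
    (e : ℕ) (he : e + 1 ≤ k)
    (hδe : ZMod.castHom (pow_dvd_pow p he) (ZMod (p ^ (e + 1))) (kuriharaNumber D.f (p ^ k) n ψ) ≠ 0) :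
    ∃ q₀ : ℚ, W.entireLFunction 1 / (W.realPeriodRat : ℂ) = (q₀ : ℂ) ∧
      padicValRat p q₀ - (e : ℤ) ≤
        (padicValNat p (Nat.card (AddCommGroup.primaryComponent W.sha p)) : ℤ) := by
  have hp2 : p ≠ 2 := by omega
  have hirr : Irr W p := hasIrreducibleModPGaloisRep_of_hasSurjectiveModNGaloisRep W p hsurj
  rw [Kim2026.castHom_kuriharaNumber D.f (pow_dvd_pow p he) n ψ
    (den_ratPlusSymbol_coprime_of_isKolyvaginProduct W p hp2 hirr hn D k)] at hδe
  have hψ' : ∀ ℓ ∈ n.primeFactors, Function.Surjective (Kim2026.reduceLog (pow_dvd_pow p he) ψ ℓ) :=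
    fun ℓ hℓ => Kim2026.reduceLog_surjective (pow_dvd_pow p he) (hψ ℓ hℓ)
  obtain ⟨q₀, hq₀, hw⟩ := hKim W p hp5 hsurj hL hfin D hc hper (e + 1) n (by omega) (hn.mono he) hcyc
    (Kim2026.reduceLog (pow_dvd_pow p he) ψ) hψ' hδe
  refine ⟨q₀, hq₀, ?_⟩
  simp only [Nat.add_sub_cancel] at hw
  linarith

/-- **The LOWER half from a level-`k` Kurihara number of `p`-adic order `≤ e`, `e ≤ ord_p ∏ c_ℓ`** (the
`e`-version of `missingLowerBoundAt_rankZero_of_kimLower`; rank `0`, `p ≥ 5`, any reduction at `p`,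
`ρ̄_{E,p}` onto, Manin datum, period transfer): `Typed.MissingLowerBoundAt W p`. With it the class
readings of `X4/KuriharaLowerHalf.lean` (`X4.ClassX4M.bsdp_rankZero_of_kimLower`, …) and the sockets of
`X4/KuriharaLowerHalfSocket.lean` apply at the level `e + 1`. Per pair; nothing booked.
[cite: Kim2022StructureSelmer, Thm. 1.9 (6) (PDF p. 8) and §1.5.1 (PDF p. 7)] [cite: Miller2011LMS, Def. 1.1] -/
theorem missingLowerBoundAt_rankZero_of_kimLower_of_castHom_ne_zero
    (hKim : Kim2026.rankZero_le_padicValNat_sha_of_kuriharaNumber_ne_zero)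
    (hGZK : rank_eq_analyticRank_of_analyticRank_le_one) (hp5 : 5 ≤ p)
    (hsurj : Surj W p) (hL : W.entireLFunction 1 ≠ 0)
    {N : ℕ} [NeZero N] (D : ModularParametrizationData W N) (hc : ¬ (p : ℤ) ∣ D.maninConstant)
    (hper : ∃ u : ℚ, ‖(u : ℚ_[p])‖ = 1 ∧ W.realPeriodRat = u * plusPeriod D.f)
    (k n : ℕ) [NeZero n] (hn : Kato.IsKolyvaginProduct W p k n)
    (hcyc : ∀ (ℓ : ℕ) [Fact ℓ.Prime], ℓ ∣ n →
      Nat.card {P : ((WeierstrassCurve.integralModelInt W).map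
          (Int.castRingHom (ZMod ℓ))).toAffine.Point // p • P = 0} ≤ p)
    (ψ : (ℓ : ℕ) → (ZMod ℓ)ˣ →* Multiplicative (ZMod (p ^ k)))
    (hψ : ∀ ℓ ∈ n.primeFactors, Function.Surjective (ψ ℓ))
    (e : ℕ) (he : e + 1 ≤ k) (het : e ≤ padicValNat p W.tamagawaProduct)
    (hδe : ZMod.castHom (pow_dvd_pow p he) (ZMod (p ^ (e + 1))) (kuriharaNumber D.f (p ^ k) n ψ) ≠ 0) :
    MissingLowerBoundAt W p := by
  have hr0 : W.analyticRank = 0 := analyticRank_eq_zero_of_entireLFunction_one_ne_zero W hL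
  have hfin : Finite W.sha := (hGZK W (by rw [hr0]; exact zero_le_one)).2
  obtain ⟨q₀, hq₀, hw⟩ := lOmegaWitness_of_kimLower_of_castHom_ne_zero W p hKim hp5 hsurj hL hfin D hc
    hper k n hn hcyc ψ hψ e he hδe
  exact missingLowerBoundAt_rankZero_of_levelReading W p hGZK
    (hasIrreducibleModPGaloisRep_of_hasSurjectiveModNGaloisRep W p hsurj) hL het ⟨q₀, hq₀, by linarith⟩

end Summit.BirchSwinnertonDyer.Rank1Residual.X4

end
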